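import Mathlib.LinearAlgebra.Matrix.ToLin
import Mathlib.LinearAlgebra.FreeModule.Basic
import Mathlib.LinearAlgebra.Basis.VectorSpace
import Mathlib.Analysis.RCLike.Basic
import Mathlib.Data.Nat.Cast.Field
import HarnessLib

/-!
# The real kernel of an integer matrix is spanned by its integer kernel

Support file (pure linear algebra, no named fact) for the dual / monopole-gas representation of
abelian lattice gauge theories (proof programme of
`Literature.MathematicalPhysics.QuantumFieldTheory.FrohlichSpencerU1PerimeterLawD4`). The closed
REAL plaquette fields of a box (the subspace `closedFlux` of `U1CoulombEnergy`, in which the Coulomb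
field `ε` of a sheet is the orthogonal complement component) form the real kernel of the integer
boundary matrix, while the axial gauge (`CubeChainsAxialGauge.gaugeMatrix_spec`) parametrises the
closed INTEGER fields. To identify the real range of the gauge matrix with `closedFlux` (needed to
translate the dual variables by a real potential of the sheet, FS82 §2.7 (2.49)–(2.54)) one uses the
elementary fact proved here: a real vector annihilated by an integer matrix is a real linear
combination of integer vectors annihilated by it (via a Hamel basis of `ℝ` over `ℚ` and clearing
denominators).

* `exists_int_mul_eq_of_rat` — clearing denominators of a rational kernel vector;
* `mem_span_ratKer_of_mulVec_eq_zero` — real kernel vectors lie in the real span of the rational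
  kernel;
* `realKer_eq_span_intKer` — **`ker (D : ℝⁿ → ℝᵐ) = span_ℝ {w ∈ ℤⁿ | Dw = 0}`**.

Everything is proved; no named fact is introduced.

## References

* J. Fröhlich, T. Spencer, Comm. Math. Phys. 83 (1982) 411–454, §2.7 (2.49)–(2.54). [FrohlichSpencerCMP1982]
-/

noncomputable section

open Matrix Finset Function Module

namespace Literature.Algebra.EuclideanLattices

namespace IntegerKernelBasis

variable {m n : Type*} [Fintype n]

/-- The integer kernel vectors of `D`, as real vectors. [folklore] -/
def intKerReal (D : Matrix m n ℤ) : Set (n → ℝ) :=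
  (fun w : n → ℤ => fun j => (w j : ℝ)) '' {w | D *ᵥ w = 0}

/-- **Clearing denominators**: a rational vector annihilated by the integer matrix `D` is `d⁻¹ w` for
a positive integer `d` and an INTEGER vector `w` annihilated by `D`. [folklore] -/
theorem exists_int_mul_eq_of_rat (D : Matrix m n ℤ) (v : n → ℚ)
    (hv : (D.map (Int.cast : ℤ → ℚ)) *ᵥ v = 0) :
    ∃ (d : ℕ) (w : n → ℤ), 0 < d ∧ D *ᵥ w = 0 ∧ ∀ j, (w j : ℚ) = d * v j := by
  classical
  set d : ℕ := ∏ j, (v j).den with hd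
  have hdpos : 0 < d := Finset.prod_pos fun j _ => (v j).den_pos
  have hdvd : ∀ j, (v j).den ∣ d := fun j => Finset.dvd_prod_of_mem _ (Finset.mem_univ j)
  set w : n → ℤ := fun j => ((d / (v j).den : ℕ) : ℤ) * (v j).num with hw
  have hwq : ∀ j, (w j : ℚ) = d * v j := by
    intro j
    have hden : ((v j).den : ℚ) ≠ 0 := by exact_mod_cast (v j).den_pos.ne'
    simp only [hw, Int.cast_mul, Int.cast_natCast]
    rw [Nat.cast_div (hdvd j) (by exact_mod_cast (v j).den_pos.ne'), mul_comm, ← mul_div_assoc,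
      mul_comm ((v j).num : ℚ), mul_div_assoc, Rat.num_div_den]
  refine ⟨d, w, hdpos, ?_, hwq⟩
  -- `D w = 0` after casting to `ℚ`
  funext i
  have hcast : (((D *ᵥ w) i : ℤ) : ℚ) = ((D.map (Int.cast : ℤ → ℚ)) *ᵥ (fun j => (w j : ℚ))) i := by
    simp [Matrix.mulVec, dotProduct, Matrix.map_apply]
  have hvec : (fun j => (w j : ℚ)) = (d : ℚ) • v := by
    funext j; rw [hwq]; rfl
  have h0 : ((D.map (Int.cast : ℤ → ℚ)) *ᵥ (fun j => (w j : ℚ))) i = 0 := by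
    rw [hvec, Matrix.mulVec_smul, hv]; simp
  rw [← hcast] at h0
  exact_mod_cast h0

/-- A real vector annihilated by `D` lies in the real span of the RATIONAL kernel of `D` (Hamel basis
of `ℝ` over `ℚ`). [folklore] -/
theorem mem_span_ratKer_of_mulVec_eq_zero (D : Matrix m n ℤ) (x : n → ℝ)
    (hx : (D.map (Int.cast : ℤ → ℝ)) *ᵥ x = 0) :
    x ∈ Submodule.span ℝ ((fun v : n → ℚ => fun j => (v j : ℝ)) ''
      {v | (D.map (Int.cast : ℤ → ℚ)) *ᵥ v = 0}) := by
  classical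
  -- a `ℚ`-basis of `ℝ` and the coordinates of the entries of `x`
  set b := Module.Free.chooseBasis ℚ ℝ with hb
  set r : n → (Module.Free.ChooseBasisIndex ℚ ℝ →₀ ℚ) := fun j => b.repr (x j) with hr
  set T : Finset (Module.Free.ChooseBasisIndex ℚ ℝ) := Finset.univ.biUnion fun j => (r j).support with hT
  -- the rational vectors `q^α`, one per basis index
  set q : Module.Free.ChooseBasisIndex ℚ ℝ → n → ℚ := fun α j => r j α with hq
  -- each `q^α` is annihilated by `D`
  have hqker : ∀ α, (D.map (Int.cast : ℤ → ℚ)) *ᵥ q α = 0 := by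
    intro α
    funext i
    -- apply the `ℤ`-linear map `repr` to the `i`-th row of `D x = 0`
    have hrow : ∑ j, (D i j : ℤ) • x j = 0 := by
      have := congrFun hx i
      simp only [Matrix.mulVec, dotProduct, Matrix.map_apply, Pi.zero_apply] at this
      simpa [zsmul_eq_mul] using this
    have hrepr : b.repr (∑ j, (D i j : ℤ) • x j) = ∑ j, (D i j : ℤ) • r j := by
      rw [map_sum]
      exact Finset.sum_congr rfl fun j _ => by rw [map_zsmul]
    rw [hrow, map_zero] at hrepr
    have hα := congrArg (fun f : Module.Free.ChooseBasisIndex ℚ ℝ →₀ ℚ => f α) hrepr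
    simp only [Finsupp.coe_zero, Pi.zero_apply, Finsupp.coe_finsetSum, Finset.sum_apply,
      Finsupp.coe_smul, zsmul_eq_mul] at hα
    simp only [Matrix.mulVec, dotProduct, Matrix.map_apply, hq, Pi.zero_apply]
    exact hα.symm
  -- `x = ∑_{α ∈ T} b α • q^α`
  have hx_eq : x = ∑ α ∈ T, (b α) • (fun j => (q α j : ℝ)) := by
    funext j
    have h1 : x j = ∑ α ∈ (r j).support, (r j α) • b α := by
      conv_lhs => rw [← b.linearCombination_repr (x j)]
      rw [Finsupp.linearCombination_apply, Finsupp.sum]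
    have h2 : ∑ α ∈ (r j).support, (r j α) • b α = ∑ α ∈ T, (r j α) • b α := by
      refine Finset.sum_subset (Finset.subset_biUnion_of_mem (fun j => (r j).support) (Finset.mem_univ j)) ?_
      intro α _ hα
      rw [Finsupp.notMem_support_iff.1 hα, zero_smul]
    rw [h1, h2, Finset.sum_apply]
    refine Finset.sum_congr rfl fun α _ => ?_
    simp only [Pi.smul_apply, smul_eq_mul, hq]
    rw [Rat.smul_def, mul_comm]
  rw [hx_eq]
  refine Submodule.sum_mem _ fun α _ => Submodule.smul_mem _ _ (Submodule.subset_span ?_)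
  exact ⟨q α, hqker α, rfl⟩

/-- Integer kernel vectors are real kernel vectors. [folklore] -/
theorem intKerReal_subset_ker (D : Matrix m n ℤ) :
    intKerReal D ⊆ (LinearMap.ker (Matrix.mulVecLin (D.map (Int.cast : ℤ → ℝ))) : Set (n → ℝ)) := by
  rintro _ ⟨w, hw, rfl⟩
  simp only [SetLike.mem_coe, LinearMap.mem_ker, Matrix.mulVecLin_apply]
  funext i
  have h0 := congrFun hw i
  simp only [Matrix.mulVec, dotProduct, Pi.zero_apply] at h0 ⊢
  simp only [Matrix.map_apply]
  exact_mod_cast h0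

/-- **The real kernel of an integer matrix is the real span of its integer kernel.** [folklore] -/
theorem realKer_eq_span_intKer (D : Matrix m n ℤ) :
    LinearMap.ker (Matrix.mulVecLin (D.map (Int.cast : ℤ → ℝ))) = Submodule.span ℝ (intKerReal D) := by
  classical
  apply le_antisymm
  · intro x hx
    have hx' : (D.map (Int.cast : ℤ → ℝ)) *ᵥ x = 0 := by
      simpa [Matrix.mulVecLin_apply] using hx
    have h1 := mem_span_ratKer_of_mulVec_eq_zero D x hx'
    -- the rational kernel lies in the span of the integer kernel
    refine (Submodule.span_le.2 ?_ : Submodule.span ℝ _ ≤ Submodule.span ℝ (intKerReal D)) h1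
    rintro _ ⟨v, hv, rfl⟩
    obtain ⟨d, w, hd, hw, hwv⟩ := exists_int_mul_eq_of_rat D v hv
    have hd0 : (d : ℝ) ≠ 0 := by exact_mod_cast hd.ne'
    have heq : (fun j => ((v j : ℚ) : ℝ)) = (d : ℝ)⁻¹ • fun j => (w j : ℝ) := by
      funext j
      simp only [Pi.smul_apply, smul_eq_mul]
      have : ((w j : ℚ) : ℝ) = d * (v j : ℝ) := by rw [hwv j]; push_cast; rfl
      rw [Rat.cast_intCast] at this
      rw [this, ← mul_assoc, inv_mul_cancel₀ hd0, one_mul]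
    show (fun j => ((v j : ℚ) : ℝ)) ∈ Submodule.span ℝ (intKerReal D)
    rw [heq]
    exact Submodule.smul_mem _ _ (Submodule.subset_span ⟨w, hw, rfl⟩)
  · rw [Submodule.span_le]
    exact intKerReal_subset_ker D

end IntegerKernelBasis

end Literature.Algebra.EuclideanLattices
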